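import Summits.CriticalPhenomena.PercolationContinuityZ3.Theorems.PercNearOneGluingNoHeavyLowerTailKnQuestion8CoefficientwiseRemSPSeriesShapeN
import Summits.CriticalPhenomena.PercolationContinuityZ3.Theorems.PercNearOneGluingNoHeavyLowerTailKnQuestion8CoefficientwiseRemSPSeriesShapeR
import Summits.CriticalPhenomena.PercolationContinuityZ3.Theorems.PercNearOneGluingNoHeavyLowerTailKnQuestion8CoefficientwiseRemSPSeriesMaps
import Summits.CriticalPhenomena.PercolationContinuityZ3.Theorems.PercNearOneGluingNoHeavyLowerTailKnQuestion8CoefficientwiseGluing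
import Summits.CriticalPhenomena.PercolationContinuityZ3.Theorems.PercNearOneGluingNoHeavyLowerTailKnQuestion8CoefficientwiseTrivialCoreFlip
import HarnessLib

/-!
# THEOREM U3-CLOSURE, series step: 𝒰 is closed under series composition — prim-lf-2 gen 69

Support file (`--supports stmt-CriticalPhenomena-4575`, closed), prover `prim-lf-2` (gen 69).  No definitions, no named facts, no sorries; standard axioms.
Memo `prim-lf-2/CW-SP-gen69.md` §4.2 (SERIES) with the definitions of `…CoefficientwiseRemSPPieces.lean`.

Setting: disjoint edge sets `D₁` (terminals `x`, `m`) and `D₂` (terminals `m`, `h`), `x, m, h` pairwise distinct, whose edges share only the junction `m`, `x` on no edge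
of `D₂`, `h` on no edge of `D₁`; `D = D₁ ∪ D₂` with terminals `x, h` (series composition).  By the one-vertex gluing lemma `mem_openCluster_union_glue`,
`C_x^D(t) = C_x(t₁) ∪ [m ∈ C_x t₁]·C_m(t₂)` etc.  THE RULE (memo §4.2): act on the `x`-side component `D₁` — by its `R0`/`R1` row if it is red-through (`m ∈ C_x t₁`,
`m ∉ C_x(D₁∖t₁)`), by its `N` row if it is in class `N`, by the complement if it is in the self-conjugate class `N011·`, keeping `t₂`; and if `D₁` is both-through
(`m ∈ C_x t₁ ∩ C_x(D₁∖t₁)`) complement `D₁` and act on `D₂` by the composite's own row.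
* `Coefficientwise.inU3_series` — **if `(D₁;x,m), (D₂;m,h) ∈ 𝒰` then `(D₁ ∪ D₂; x, h) ∈ 𝒰`**.  Ingredients: the class dictionaries `series_pieceN_iff` / `series_pieceR_iff`
  (…RemSPSeriesShapeN/R.lean) and the single-piece class maps `exists_series_classMap` (…RemSPSeriesMaps.lean).
[cite: KozmaNitzan2024, Questions 8–9 (§5.5 p. 36) (context: the Question-8 pocket covariance programme)]
-/

namespace Summit.CriticalPhenomena.PercolationContinuityZ3.Theorems

open Finset Literature.Probability.Percolation

namespace Coefficientwise

variable {ι V : Type*} [DecidableEq ι] (ends : ι → Sym2 V)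

open Classical in
/-- **𝒰 is closed under series composition.**  [cite: KozmaNitzan2024, Questions 8–9 (§5.5 p. 36) (context)] -/
theorem inU3_series {D₁ D₂ : Finset ι} (hdisj : Disjoint D₁ D₂) {x m h : V} (hxm : x ≠ m) (hmh : m ≠ h) (hxh : x ≠ h)
    (hsep : ∀ e ∈ D₁, ∀ e' ∈ D₂, ∀ w : V, w ∈ ends e → w ∈ ends e' → w = m)
    (hxD₂ : ∀ e ∈ D₂, x ∉ ends e) (hhD₁ : ∀ e ∈ D₁, h ∉ ends e)
    (h₁ : InU3 ends D₁ x m) (h₂ : InU3 ends D₂ m h) : InU3 ends (D₁ ∪ D₂) x h := by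
  intro W
  obtain ⟨hA₁, hB₁, hC₁⟩ := h₁ W
  obtain ⟨hA₂, hB₂, hC₂⟩ := h₂ W
  set D : Finset ι := D₁ ∪ D₂ with hD
  set Cx : Finset ι → Set V := fun s => openCluster (ends '' (↑s : Set ι)) x with hCx
  set Cm : Finset ι → Set V := fun s => openCluster (ends '' (↑s : Set ι)) m with hCm
  set Ch : Finset ι → Set V := fun s => openCluster (ends '' (↑s : Set ι)) h with hCh
  -- gluing for domination
  have GX : ∀ s₁, s₁ ⊆ D₁ → ∀ s₂, s₂ ⊆ D₂ → ∀ y, (y ∈ Cx (s₁ ∪ s₂) ↔ y ∈ Cx s₁ ∨ (m ∈ Cx s₁ ∧ y ∈ Cm s₂)) := by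
    intro s₁ hs₁ s₂ hs₂ y
    exact mem_openCluster_union_glue ends (fun e he e' he' w hw hw' => hsep e (hs₁ he) e' (hs₂ he') w hw hw')
      (fun e he hx => absurd hx (hxD₂ e (hs₂ he))) y
  have hdecomp : ∀ t, t ⊆ D → t = (t ∩ D₁) ∪ (t ∩ D₂) := by
    intro t ht; ext i
    simp only [Finset.mem_union, Finset.mem_inter]
    constructor
    · intro hi; rcases Finset.mem_union.mp (ht hi) with h1 | h2
      · exact Or.inl ⟨hi, h1⟩
      · exact Or.inr ⟨hi, h2⟩
    · rintro (⟨hi, _⟩ | ⟨hi, _⟩) <;> exact hi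
  have hsdiff : ∀ s₁, s₁ ⊆ D₁ → ∀ s₂, s₂ ⊆ D₂ → D \ (s₁ ∪ s₂) = (D₁ \ s₁) ∪ (D₂ \ s₂) :=
    fun s₁ hs₁ s₂ hs₂ => union_sdiff_union_of_subset hdisj hs₁ hs₂
  have hinter₁ : ∀ s₁, s₁ ⊆ D₁ → ∀ s₂, s₂ ⊆ D₂ → (s₁ ∪ s₂) ∩ D₁ = s₁ := by
    intro s₁ hs₁ s₂ hs₂; ext i
    simp only [Finset.mem_inter, Finset.mem_union]
    constructor
    · rintro ⟨h12 | h12, hi1⟩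
      · exact h12
      · exact absurd (Finset.mem_inter.mpr ⟨hi1, hs₂ h12⟩) (Finset.disjoint_iff_inter_eq_empty.mp hdisj ▸ Finset.notMem_empty i)
    · intro hi; exact ⟨Or.inl hi, hs₁ hi⟩
  have hinter₂ : ∀ s₁, s₁ ⊆ D₁ → ∀ s₂, s₂ ⊆ D₂ → (s₁ ∪ s₂) ∩ D₂ = s₂ := by
    intro s₁ hs₁ s₂ hs₂; ext i
    simp only [Finset.mem_inter, Finset.mem_union]
    constructor
    · rintro ⟨h12 | h12, hi2⟩
      · exact absurd (Finset.mem_inter.mpr ⟨hs₁ h12, hi2⟩) (Finset.disjoint_iff_inter_eq_empty.mp hdisj ▸ Finset.notMem_empty i)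
      · exact h12
    · intro hi; exact ⟨Or.inr hi, hs₂ hi⟩
  -- a vertex in a cluster of a D₁-colouring and in a cluster of a D₂-colouring is one of the seeds or the junction
  -- the classes Z0 (both-through, no x-core) and M = N011· of D₁; 'good' colourings
  set Z0 : Finset ι → Prop := fun s => m ∈ Cx s ∧ m ∈ Cx (D₁ \ s) ∧ ∀ w ∈ W, ¬ (w ∈ Cx s ∧ w ∈ Cx (D₁ \ s)) with hZ0
  set M : Finset ι → Prop := fun s => m ∉ Cx s ∧ m ∉ Cx (D₁ \ s) ∧ (∀ w ∈ W, ¬ (w ∈ Cx s ∧ w ∈ Cx (D₁ \ s))) ∧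
      (∃ w ∈ W, w ≠ m ∧ w ∈ Cx s ∧ w ∈ Cm (D₁ \ s)) ∧ (∃ w ∈ W, w ∈ Cm s ∧ w ∈ Cx (D₁ \ s)) with hM
  set K₁ : Finset ι → Prop := fun s => pieceR1 ends D₁ x m W s ∨ pieceR0 ends D₁ x m W s ∨ pieceN ends D₁ x m W s ∨ M s with hK₁
  set K₂ : Finset ι → Prop := fun s => pieceR1 ends D₂ m h W s ∨ pieceR0 ends D₂ m h W s ∨ pieceN ends D₂ m h W s ∨
      (h ∉ Cm s ∧ h ∉ Cm (D₂ \ s) ∧ (∀ w ∈ W, ¬ (w ∈ Cm s ∧ w ∈ Cm (D₂ \ s))) ∧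
        (∃ w ∈ W, w ≠ h ∧ w ∈ Cm s ∧ w ∈ Ch (D₂ \ s)) ∧ (∃ w ∈ W, w ∈ Ch s ∧ w ∈ Cm (D₂ \ s))) with hK₂
  have Z0_compl : ∀ s, s ⊆ D₁ → Z0 s → Z0 (D₁ \ s) := by
    intro s hs ⟨ha, hb, hn⟩
    refine ⟨hb, ?_, ?_⟩
    · show m ∈ Cx (D₁ \ (D₁ \ s)); rw [Finset.sdiff_sdiff_eq_self hs]; exact ha
    · intro w hw hh; rw [Finset.sdiff_sdiff_eq_self hs] at hh; exact hn w hw ⟨hh.2, hh.1⟩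
  have nZ_R1 : ∀ s, pieceR1 ends D₁ x m W s → ¬ Z0 s := fun s hc hz => hc.2.1 hz.2.1
  have nZ_R0 : ∀ s, pieceR0 ends D₁ x m W s → ¬ Z0 s := fun s hc hz => hc.2.1 hz.2.1
  have nZ_N : ∀ s, pieceN ends D₁ x m W s → ¬ Z0 s := fun s hc hz => hc.1 hz.1
  have nZ_M : ∀ s, M s → ¬ Z0 s := fun s hc hz => hc.1 hz.1
  -- the class dictionaries of the composite and the single-piece class maps
  have NIFF := series_pieceN_iff ends hdisj hxm hmh hxh hsep hxD₂ hhD₁ W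
  have RIFF := series_pieceR_iff ends hdisj hxm hmh hxh hsep hxD₂ hhD₁ W
  obtain ⟨g₁, g₁p, g₁i⟩ := exists_series_classMap ends D₁ x m W hA₁ hB₁ hC₁
  obtain ⟨g₂, g₂p, g₂i⟩ := exists_series_classMap ends D₂ m h W hA₂ hB₂ hC₂
  -- the map
  set Pm : Finset ι → Finset ι := fun t => if Z0 (t ∩ D₁) then (D₁ \ (t ∩ D₁)) ∪ g₂ (t ∩ D₂) else g₁ (t ∩ D₁) ∪ (t ∩ D₂) with hPm
  have Pm_Z : ∀ t, Z0 (t ∩ D₁) → Pm t = (D₁ \ (t ∩ D₁)) ∪ g₂ (t ∩ D₂) := fun t hz => by simp only [hPm, if_pos hz]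
  have Pm_nZ : ∀ t, ¬ Z0 (t ∩ D₁) → Pm t = g₁ (t ∩ D₁) ∪ (t ∩ D₂) := fun t hz => by simp only [hPm, if_neg hz]
  -- image decomposition for good colourings
  have img : ∀ u, u ⊆ D → ((Z0 (u ∩ D₁) ∧ K₂ (u ∩ D₂)) ∨ (¬ Z0 (u ∩ D₁) ∧ K₁ (u ∩ D₁))) →
      ∃ s₁ s₂, s₁ ⊆ D₁ ∧ s₂ ⊆ D₂ ∧ Pm u = s₁ ∪ s₂ ∧ (Z0 s₁ ↔ Z0 (u ∩ D₁)) ∧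
        (Z0 (u ∩ D₁) → (s₁ = D₁ \ (u ∩ D₁) ∧ s₂ = g₂ (u ∩ D₂))) ∧ (¬ Z0 (u ∩ D₁) → (s₁ = g₁ (u ∩ D₁) ∧ s₂ = u ∩ D₂)) := by
    intro u hu hk
    rcases hk with ⟨hz, hk2⟩ | ⟨hnz, hk1⟩
    · have hs2 : g₂ (u ∩ D₂) ⊆ D₂ := by
        rcases hk2 with c | c | c | c
        · exact ((g₂p _ Finset.inter_subset_right).1 c).1
        · exact ((g₂p _ Finset.inter_subset_right).2.1 c).1
        · exact ((g₂p _ Finset.inter_subset_right).2.2.1 c).1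
        · exact ((g₂p _ Finset.inter_subset_right).2.2.2 c).1
      exact ⟨D₁ \ (u ∩ D₁), g₂ (u ∩ D₂), Finset.sdiff_subset, hs2, Pm_Z u hz,
        ⟨fun _ => hz, fun _ => Z0_compl _ Finset.inter_subset_right hz⟩, fun _ => ⟨rfl, rfl⟩, fun hnz => absurd hz hnz⟩
    · have hs1 : g₁ (u ∩ D₁) ⊆ D₁ ∧ ¬ Z0 (g₁ (u ∩ D₁)) := by
        rcases hk1 with c | c | c | c
        · exact ⟨((g₁p _ Finset.inter_subset_right).1 c).1, nZ_R1 _ ((g₁p _ Finset.inter_subset_right).1 c).2.1⟩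
        · exact ⟨((g₁p _ Finset.inter_subset_right).2.1 c).1, nZ_R0 _ ((g₁p _ Finset.inter_subset_right).2.1 c).2.1⟩
        · exact ⟨((g₁p _ Finset.inter_subset_right).2.2.1 c).1, nZ_N _ ((g₁p _ Finset.inter_subset_right).2.2.1 c).2.1⟩
        · exact ⟨((g₁p _ Finset.inter_subset_right).2.2.2 c).1, nZ_M _ ((g₁p _ Finset.inter_subset_right).2.2.2 c).2.1⟩
      exact ⟨g₁ (u ∩ D₁), u ∩ D₂, hs1.1, Finset.inter_subset_right, Pm_nZ u hnz,
        ⟨fun hz => absurd hz hs1.2, fun hz => absurd hz hnz⟩, fun hz => absurd hz hnz, fun _ => ⟨rfl, rfl⟩⟩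
  have Pm_inj : ∀ t t', t ⊆ D → t' ⊆ D →
      ((Z0 (t ∩ D₁) ∧ K₂ (t ∩ D₂)) ∨ (¬ Z0 (t ∩ D₁) ∧ K₁ (t ∩ D₁))) →
      ((Z0 (t' ∩ D₁) ∧ K₂ (t' ∩ D₂)) ∨ (¬ Z0 (t' ∩ D₁) ∧ K₁ (t' ∩ D₁))) → Pm t = Pm t' → t = t' := by
    intro t t' ht ht' hk hk' heq
    obtain ⟨s₁, s₂, hs₁, hs₂, hP, hzi, hZ, hnZ⟩ := img t ht hk
    obtain ⟨s₁', s₂', hs₁', hs₂', hP', hzi', hZ', hnZ'⟩ := img t' ht' hk'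
    have e1 : s₁ = s₁' := by
      have := congrArg (fun s => s ∩ D₁) heq
      simp only [hP, hP', hinter₁ s₁ hs₁ s₂ hs₂, hinter₁ s₁' hs₁' s₂' hs₂'] at this; exact this
    have e2 : s₂ = s₂' := by
      have := congrArg (fun s => s ∩ D₂) heq
      simp only [hP, hP', hinter₂ s₁ hs₁ s₂ hs₂, hinter₂ s₁' hs₁' s₂' hs₂'] at this; exact this
    have hzz : Z0 (t ∩ D₁) ↔ Z0 (t' ∩ D₁) := by rw [← hzi, ← hzi', e1]
    by_cases hz : Z0 (t ∩ D₁)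
    · have hz' := hzz.mp hz
      obtain ⟨q1, q2⟩ := hZ hz
      obtain ⟨q1', q2'⟩ := hZ' hz'
      have hk2 : K₂ (t ∩ D₂) := by
        rcases hk with ⟨_, h2⟩ | ⟨hn, _⟩
        · exact h2
        · exact absurd hz hn
      have hk2' : K₂ (t' ∩ D₂) := by
        rcases hk' with ⟨_, h2⟩ | ⟨hn, _⟩
        · exact h2
        · exact absurd hz' hn
      have r1 : t ∩ D₁ = t' ∩ D₁ := by
        have : D₁ \ (t ∩ D₁) = D₁ \ (t' ∩ D₁) := by rw [← q1, ← q1', e1]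
        rw [← Finset.sdiff_sdiff_eq_self (Finset.inter_subset_right (s₁ := t) (s₂ := D₁)), this,
          Finset.sdiff_sdiff_eq_self (Finset.inter_subset_right (s₁ := t') (s₂ := D₁))]
      have r2 : t ∩ D₂ = t' ∩ D₂ := g₂i _ _ Finset.inter_subset_right hk2 Finset.inter_subset_right hk2' (by rw [← q2, ← q2', e2])
      rw [hdecomp t ht, hdecomp t' ht', r1, r2]
    · have hz' : ¬ Z0 (t' ∩ D₁) := fun h' => hz (hzz.mpr h')
      obtain ⟨q1, q2⟩ := hnZ hz
      obtain ⟨q1', q2'⟩ := hnZ' hz'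
      have hk1 : K₁ (t ∩ D₁) := by
        rcases hk with ⟨h1, _⟩ | ⟨_, h1⟩
        · exact absurd h1 hz
        · exact h1
      have hk1' : K₁ (t' ∩ D₁) := by
        rcases hk' with ⟨h1, _⟩ | ⟨_, h1⟩
        · exact absurd h1 hz'
        · exact h1
      have r1 : t ∩ D₁ = t' ∩ D₁ := g₁i _ _ Finset.inter_subset_right hk1 Finset.inter_subset_right hk1' (by rw [← q1, ← q1', e1])
      have r2 : t ∩ D₂ = t' ∩ D₂ := by rw [← q2, ← q2', e2]
      rw [hdecomp t ht, hdecomp t' ht', r1, r2]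
  -- domination helpers
  have dom_nZ : ∀ s₁, s₁ ⊆ D₁ → ∀ s₂, s₂ ⊆ D₂ → ∀ s₁', s₁' ⊆ D₁ → m ∉ Cx (D₁ \ s₁) → Cx (D₁ \ s₁) ⊆ Cx s₁' →
      Cx (D \ (s₁ ∪ s₂)) ⊆ Cx (s₁' ∪ s₂) := by
    intro s₁ hs₁ s₂ hs₂ s₁' hs₁' hnb hd y hy
    rw [hsdiff s₁ hs₁ s₂ hs₂] at hy
    rcases (GX _ Finset.sdiff_subset _ Finset.sdiff_subset y).mp hy with h1 | ⟨hb, _⟩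
    · exact (GX _ hs₁' _ hs₂ y).mpr (Or.inl (hd h1))
    · exact absurd hb hnb
  have dom_Z : ∀ s₁, s₁ ⊆ D₁ → ∀ s₂, s₂ ⊆ D₂ → ∀ s₂', s₂' ⊆ D₂ → Z0 s₁ → Cm (D₂ \ s₂) ⊆ Cm s₂' →
      Cx (D \ (s₁ ∪ s₂)) ⊆ Cx ((D₁ \ s₁) ∪ s₂') := by
    intro s₁ hs₁ s₂ hs₂ s₂' hs₂' hz hd y hy
    rw [hsdiff s₁ hs₁ s₂ hs₂] at hy
    rcases (GX _ Finset.sdiff_subset _ Finset.sdiff_subset y).mp hy with h1 | ⟨_, h2⟩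
    · exact (GX _ Finset.sdiff_subset _ hs₂' y).mpr (Or.inl h1)
    · exact (GX _ Finset.sdiff_subset _ hs₂' y).mpr (Or.inr ⟨hz.2.1, hd h2⟩)
  ------------------------------------------------------------------
  -- the three 'main' lemmas: image in the class, domination, goodness
  ------------------------------------------------------------------
  have mainN : ∀ t, t ⊆ D → pieceN ends D x h W t →
      (Pm t ⊆ D ∧ pieceN ends D x h W (Pm t) ∧ Cx (D \ t) ⊆ Cx (Pm t) ∧
        ((Z0 (t ∩ D₁) ∧ K₂ (t ∩ D₂)) ∨ (¬ Z0 (t ∩ D₁) ∧ K₁ (t ∩ D₁)))) := by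
    intro t ht hN
    set s₁ := t ∩ D₁ with hs₁d
    set s₂ := t ∩ D₂ with hs₂d
    have hs₁ : s₁ ⊆ D₁ := Finset.inter_subset_right
    have hs₂ : s₂ ⊆ D₂ := Finset.inter_subset_right
    have htt : t = s₁ ∪ s₂ := hdecomp t ht
    rw [htt] at hN
    rcases (NIFF s₁ hs₁ s₂ hs₂).mp hN with ⟨hcls, hna2, hwit⟩ | ⟨hz, hN2⟩ | ⟨hN1, hb2⟩ | ⟨hMM, hb2, hna2⟩
    · rcases hcls with h0 | h1
      · have hnz : ¬ Z0 s₁ := nZ_R0 _ h0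
        obtain ⟨hs1', hc', hd⟩ := (g₁p s₁ hs₁).2.1 h0
        rw [Pm_nZ t hnz, ← hs₁d, ← hs₂d, htt]
        refine ⟨Finset.union_subset_union hs1' hs₂, (NIFF _ hs1' s₂ hs₂).mpr (Or.inl ⟨Or.inl hc', hna2, ?_⟩),
          dom_nZ s₁ hs₁ s₂ hs₂ _ hs1' h0.2.1 hd, Or.inr ⟨hnz, Or.inr (Or.inl h0)⟩⟩
        rcases hwit with hw2 | ⟨hb2, hmW | ⟨w, hw, hwm, hwK, hwP⟩⟩
        · exact Or.inl hw2
        · exact Or.inr ⟨hb2, Or.inl hmW⟩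
        · exact absurd (And.intro hwK hwP) (h0.2.2.2 w hw hwm)
      · have hnz : ¬ Z0 s₁ := nZ_R1 _ h1
        obtain ⟨hs1', hc', hd⟩ := (g₁p s₁ hs₁).1 h1
        rw [Pm_nZ t hnz, ← hs₁d, ← hs₂d, htt]
        refine ⟨Finset.union_subset_union hs1' hs₂, (NIFF _ hs1' s₂ hs₂).mpr (Or.inl ⟨Or.inr hc', hna2, ?_⟩),
          dom_nZ s₁ hs₁ s₂ hs₂ _ hs1' h1.2.1 hd, Or.inr ⟨hnz, Or.inl h1⟩⟩
        rcases hwit with hw2 | ⟨hb2, _⟩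
        · exact Or.inl hw2
        · exact Or.inr ⟨hb2, Or.inr hc'.2.2.2⟩
    · obtain ⟨hs2', hc', hd⟩ := (g₂p s₂ hs₂).2.2.1 hN2
      rw [Pm_Z t hz, ← hs₁d, ← hs₂d, htt]
      exact ⟨Finset.union_subset_union Finset.sdiff_subset hs2', (NIFF _ Finset.sdiff_subset _ hs2').mpr (Or.inr (Or.inl ⟨Z0_compl s₁ hs₁ hz, hc'⟩)),
        dom_Z s₁ hs₁ s₂ hs₂ _ hs2' hz hd, Or.inl ⟨hz, Or.inr (Or.inr (Or.inl hN2))⟩⟩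
    · have hnz : ¬ Z0 s₁ := nZ_N _ hN1
      obtain ⟨hs1', hc', hd⟩ := (g₁p s₁ hs₁).2.2.1 hN1
      rw [Pm_nZ t hnz, ← hs₁d, ← hs₂d, htt]
      exact ⟨Finset.union_subset_union hs1' hs₂, (NIFF _ hs1' s₂ hs₂).mpr (Or.inr (Or.inr (Or.inl ⟨hc', hb2⟩))),
        dom_nZ s₁ hs₁ s₂ hs₂ _ hs1' hN1.2.1 hd, Or.inr ⟨hnz, Or.inr (Or.inr (Or.inl hN1))⟩⟩
    · have hnz : ¬ Z0 s₁ := nZ_M _ hMM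
      obtain ⟨hs1', hc', hd⟩ := (g₁p s₁ hs₁).2.2.2 hMM
      rw [Pm_nZ t hnz, ← hs₁d, ← hs₂d, htt]
      exact ⟨Finset.union_subset_union hs1' hs₂, (NIFF _ hs1' s₂ hs₂).mpr (Or.inr (Or.inr (Or.inr ⟨hc', hb2, hna2⟩))),
        dom_nZ s₁ hs₁ s₂ hs₂ _ hs1' hMM.2.1 hd, Or.inr ⟨hnz, Or.inr (Or.inr (Or.inr hMM))⟩⟩
  have mainR0 : ∀ t, t ⊆ D → pieceR0 ends D x h W t →
      (Pm t ⊆ D ∧ pieceR0 ends D x h W (Pm t) ∧ Cx (D \ t) ⊆ Cx (Pm t) ∧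
        ((Z0 (t ∩ D₁) ∧ K₂ (t ∩ D₂)) ∨ (¬ Z0 (t ∩ D₁) ∧ K₁ (t ∩ D₁)))) := by
    intro t ht hP
    set s₁ := t ∩ D₁ with hs₁d
    set s₂ := t ∩ D₂ with hs₂d
    have hs₁ : s₁ ⊆ D₁ := Finset.inter_subset_right
    have hs₂ : s₂ ⊆ D₂ := Finset.inter_subset_right
    have htt : t = s₁ ∪ s₂ := hdecomp t ht
    rw [htt] at hP
    rcases (RIFF s₁ hs₁ s₂ hs₂).1.mp hP with ⟨h0, hA2, hnF2, hnb⟩ | ⟨h1, hA2, hnF2, hnb2⟩ | ⟨hz, h0⟩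
    · have hnz : ¬ Z0 s₁ := nZ_R0 _ h0
      obtain ⟨hs1', hc', hd⟩ := (g₁p s₁ hs₁).2.1 h0
      rw [Pm_nZ t hnz, ← hs₁d, ← hs₂d, htt]
      exact ⟨Finset.union_subset_union hs1' hs₂, (RIFF _ hs1' s₂ hs₂).1.mpr (Or.inl ⟨hc', hA2, hnF2, hnb⟩),
        dom_nZ s₁ hs₁ s₂ hs₂ _ hs1' h0.2.1 hd, Or.inr ⟨hnz, Or.inr (Or.inl h0)⟩⟩
    · have hnz : ¬ Z0 s₁ := nZ_R1 _ h1
      obtain ⟨hs1', hc', hd⟩ := (g₁p s₁ hs₁).1 h1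
      rw [Pm_nZ t hnz, ← hs₁d, ← hs₂d, htt]
      exact ⟨Finset.union_subset_union hs1' hs₂, (RIFF _ hs1' s₂ hs₂).1.mpr (Or.inr (Or.inl ⟨hc', hA2, hnF2, hnb2⟩)),
        dom_nZ s₁ hs₁ s₂ hs₂ _ hs1' h1.2.1 hd, Or.inr ⟨hnz, Or.inl h1⟩⟩
    · obtain ⟨hs2', hc', hd⟩ := (g₂p s₂ hs₂).2.1 h0
      rw [Pm_Z t hz, ← hs₁d, ← hs₂d, htt]
      exact ⟨Finset.union_subset_union Finset.sdiff_subset hs2', (RIFF _ Finset.sdiff_subset _ hs2').1.mpr (Or.inr (Or.inr ⟨Z0_compl s₁ hs₁ hz, hc'⟩)),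
        dom_Z s₁ hs₁ s₂ hs₂ _ hs2' hz hd, Or.inl ⟨hz, Or.inr (Or.inl h0)⟩⟩
  have mainR1 : ∀ t, t ⊆ D → pieceR1 ends D x h W t →
      (Pm t ⊆ D ∧ pieceR1 ends D x h W (Pm t) ∧ Cx (D \ t) ⊆ Cx (Pm t) ∧
        ((Z0 (t ∩ D₁) ∧ K₂ (t ∩ D₂)) ∨ (¬ Z0 (t ∩ D₁) ∧ K₁ (t ∩ D₁)))) := by
    intro t ht hP
    set s₁ := t ∩ D₁ with hs₁d
    set s₂ := t ∩ D₂ with hs₂d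
    have hs₁ : s₁ ⊆ D₁ := Finset.inter_subset_right
    have hs₂ : s₂ ⊆ D₂ := Finset.inter_subset_right
    have htt : t = s₁ ∪ s₂ := hdecomp t ht
    rw [htt] at hP
    rcases (RIFF s₁ hs₁ s₂ hs₂).2.mp hP with ⟨h0, hA2, hF⟩ | ⟨h1, hA2, hF⟩ | ⟨hz, h1⟩
    · have hnz : ¬ Z0 s₁ := nZ_R0 _ h0
      obtain ⟨hs1', hc', hd⟩ := (g₁p s₁ hs₁).2.1 h0
      rw [Pm_nZ t hnz, ← hs₁d, ← hs₂d, htt]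
      exact ⟨Finset.union_subset_union hs1' hs₂, (RIFF _ hs1' s₂ hs₂).2.mpr (Or.inl ⟨hc', hA2, hF⟩),
        dom_nZ s₁ hs₁ s₂ hs₂ _ hs1' h0.2.1 hd, Or.inr ⟨hnz, Or.inr (Or.inl h0)⟩⟩
    · have hnz : ¬ Z0 s₁ := nZ_R1 _ h1
      obtain ⟨hs1', hc', hd⟩ := (g₁p s₁ hs₁).1 h1
      rw [Pm_nZ t hnz, ← hs₁d, ← hs₂d, htt]
      exact ⟨Finset.union_subset_union hs1' hs₂, (RIFF _ hs1' s₂ hs₂).2.mpr (Or.inr (Or.inl ⟨hc', hA2, hF⟩)),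
        dom_nZ s₁ hs₁ s₂ hs₂ _ hs1' h1.2.1 hd, Or.inr ⟨hnz, Or.inl h1⟩⟩
    · obtain ⟨hs2', hc', hd⟩ := (g₂p s₂ hs₂).1 h1
      rw [Pm_Z t hz, ← hs₁d, ← hs₂d, htt]
      exact ⟨Finset.union_subset_union Finset.sdiff_subset hs2', (RIFF _ Finset.sdiff_subset _ hs2').2.mpr (Or.inr (Or.inr ⟨Z0_compl s₁ hs₁ hz, hc'⟩)),
        dom_Z s₁ hs₁ s₂ hs₂ _ hs2' hz hd, Or.inl ⟨hz, Or.inl h1⟩⟩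
  -- assemble
  refine ⟨⟨Pm, fun t ht hP => ⟨(mainR0 t ht hP).1, (mainR0 t ht hP).2.1⟩,
      fun t t' ht hP ht' hP' heq => Pm_inj t t' ht ht' (mainR0 t ht hP).2.2.2 (mainR0 t' ht' hP').2.2.2 heq,
      fun t ht hP => (mainR0 t ht hP).2.2.1⟩,
    ⟨Pm, fun t ht hP => ⟨(mainR1 t ht hP).1, (mainR1 t ht hP).2.1⟩,
      fun t t' ht hP ht' hP' heq => Pm_inj t t' ht ht' (mainR1 t ht hP).2.2.2 (mainR1 t' ht' hP').2.2.2 heq,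
      fun t ht hP => (mainR1 t ht hP).2.2.1⟩,
    ⟨Pm, fun t ht hP => ⟨(mainN t ht hP).1, (mainN t ht hP).2.1⟩,
      fun t t' ht hP ht' hP' heq => Pm_inj t t' ht ht' (mainN t ht hP).2.2.2 (mainN t' ht' hP').2.2.2 heq,
      fun t ht hP => (mainN t ht hP).2.2.1⟩⟩

end Coefficientwise

end Summit.CriticalPhenomena.PercolationContinuityZ3.Theorems
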